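import Summits.QuantumFields.YangMills.Theorems.BalabanUVNodesN09RegularityTowerOfLocalRoute
import Summits.QuantumFields.YangMills.Theorems.BalabanUVNodesN09HierarchyBindersOfLevelwiseThm1
import HarnessLib

/-!
# BalabanUVNodes ∕ N09 — ROAD B's TOWER AND DOOR IN ROAD A′'s CURRENCY: the loop-guard radius `α`, the hierarchy-uniqueness binder `huniq` and the non-strict (hord) are NOT letters

Cell `pub-ymgap`, width seat `pub-ymgap-dag-n09-w2` generation 5 (HUMAN RULING D-0149; DAG node N09 = [Balaban1987RG1] §§2–5; INBOX CLAIM-4∕INTENT-8).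
`--kind proof --supports stmt-QuantumFields-27364 --as helper` (K1⁹ `StabilityBRunRowsAtRecordR13SepCoPHV`; count-neutral; theorems only, 0 def ∕ 0 instance ∕ 0 notation ∕ 0 sorry).

WHY.  This seat's `…N09RegularityTowerOfLocalRoute` (p639613) displays, besides the LOCAL data ((H-U), (I19), `hsolν`, on-domain hcrit) and [B11]'s binders, FOUR loop-guard letters
`hαB : (ℓ²∕4)·Q < α`, `hα24 : α ≤ 1∕24`, `hαδ : α < δ_N`, `hαL : 157·α < L^{1−d}` (`ℓ = (d+2)L`, `Q = 2εreg∕L² + 4·max(ε₂₉, 10ℓε₂₉L^{d−1})`).  dag-n09-w4 g6 observed for road A′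
(`…N09WindowRadiusOfRecord`, `…N09TowerOfNumericsAlphaFree`) that such an `α` is not a letter: with the strict (hord) `Q < ε₀` the choice `α := (ℓ²∕4)·ε₀` turns the four letters into the THREE
`ε₀`-LINES `(ℓ²∕4)·ε₀ < 1∕24`, `64·((ℓ²∕4)·ε₀) < δ_N`, `157·((ℓ²∕4)·ε₀) < L^{1−d}` — road A′'s currency.  §1–§2 do the same swap for ROAD B (tower and door), so the K0-numerics knit reads ONE
numerics row for both roads; §2 moreover DISCHARGES the door's hierarchy-uniqueness binder `huniq` by dag-n09-w1 g7's `huniq_of_h11` (its letter `2εbg ≤ ε₀·L²` is a theorem of the strict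
(hord) at `εreg = εbg`) and the non-strict (hord) by the strict one.

WHAT IS PROVED (theorems only).
§1 `windowRadius_pos` (bookkeeping: `0 < (ℓ²∕4)`), ★★ `hreg_pos_all_of_localSupportSet_alphaFree` (p639613's `hreg_pos_all_of_localSupportSet` with the four guard letters replaced by the three
   `ε₀`-lines; `0 < ε₀` is a theorem of (hord)).
§2 `two_mul_εbg_le_of_hord` (the `huniq_of_h11` letter from the strict (hord) at `εreg = εbg`), ★★★ `thm3Member_stage13SepCoPH_atDomAlt_of_localRoute_of_numerics_of_εreg_eq_alphaFree`
   (p639613's door with `α`, `hαB hα24 hαδ hαL`, `huniq` AND the non-strict `hord` GONE: displayed = `hC`, `0 < ε₂₉`, `εreg = εbg`, [B7] on `εreg`, the rider's `hn1 hn2`, (181)ˢᵒˡ `hcov`,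
   `hsolν`, (I19) `hint`, (H-U) `hρm`, on-domain hcrit, the three `ε₀`-lines, strict (hord), `0 ≤ ε₀`, `((dL)²∕4)·ε₀ < δ_Fed`, the level-wise `h11`, `hres`).

HONEST FRAMING.  Count-neutral re-keying BY NAME (two specialisations `α := (ℓ²∕4)·ε₀` + one binder discharged by a sibling's theorem); NOTHING of Bałaban's asserted; [B11] Thm 1 enters
only as displayed hypotheses (`h11`, `hres`, `hsolν`); `hreg`∕(F3) at the record rest on the displayed LOCAL data; N09 NOT discharged; conjunct 1 (Lemma 4) ∕ FLAG №7 untouched; K0⁷ ∕ K1⁹ ∕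
K2⁹ ∕ K3⁸ NOT closed; counts unmoved (typed 28∕28 · discharged 5∕28); no summit statement is proved here; R4 = the conditional finite-𝕋⁴ rung `BalabanLadder.UV` only — NOT continuum ∕
ℝ⁴ ∕ OS; the Yang–Mills mass gap (Clay) is NOT proved by any of this.
-/

noncomputable section

open Filter Topology Set Function MeasureTheory

namespace Summit.QuantumFields.YangMills.BalabanUVNodes.N09RegularityTowerOfLocalRouteAlphaFree

open Literature.MathematicalPhysics.QuantumFieldTheory.Balaban1983to89
open Literature.MathematicalPhysics.QuantumFieldTheory.Balaban1983to89.Node00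
open Literature.MathematicalPhysics.QuantumFieldTheory.Balaban1983to89.T4Continuum (T4Family)
open Literature.MathematicalPhysics.QuantumFieldTheory.Balaban1983to89.DagBinding (WorldP leavesP)
open Literature.MathematicalPhysics.QuantumFieldTheory.Balaban1983to89.B12RTGaugeInvariance254 (liftTransf)
open Literature.MathematicalPhysics.QuantumFieldTheory.Balaban1983to89.GaugeField (gaugeAct)
open Literature.MathematicalPhysics.QuantumFieldTheory.Balaban1983to89.ExpMeanLog (expMeanLogSU deltaSU)
open Literature.MathematicalPhysics.QuantumFieldTheory.Balaban1983to89.FederbushMean (deltaFed)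
open Summit.QuantumFields.YangMills.BalabanUVNodes.N09RegularityTowerOfLocalRoute
  (hreg_pos_all_of_localSupportSet thm3Member_stage13SepCoPH_atDomAlt_of_localRoute_of_numerics_of_εreg_eq)
open Summit.QuantumFields.YangMills.BalabanUVNodes.N09HierarchyBindersOfLevelwiseThm1 (huniq_of_h11)

variable {F : T4Family} {N : ℕ} [NeZero N]

/-! ## §1 The tower of p639613 in road A′'s currency -/

section Tower

variable (θ₀ : Stage13Params F N) (K : ℕ) (g : ℕ → ℝ)

/-- Bookkeeping: the window-radius scale `((d+2)L)²∕4` is positive. [cite: Balaban1987RG1, p.259 (bookkeeping)] -/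
theorem windowRadius_pos (K : ℕ) : (0 : ℝ) < ((((F.P K).d + 2) * (F.P K).L : ℕ) : ℝ) ^ 2 / 4 :=
  div_pos (pow_pos (by exact_mod_cast Nat.mul_pos (by omega) (F.P K).L_pos) 2) four_pos

/-- ★★ **ROAD B's `hreg_j` ∧ (F3)_j FOR EVERY `j < K`, α-FREE** (p639613's `hreg_pos_all_of_localSupportSet` at `α := (((d+2)L)²∕4)·ε₀`: `hαB` ⇐ strict (hord), `hα24`∕`hαδ`∕`hαL` ⇐ the three `ε₀`-lines,
`0 ≤ ε₀` ⇐ (hord)). [cite: Balaban1987RG1, p.259, (0.19) p.255 and (2.10) p.267] -/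
theorem hreg_pos_all_of_localSupportSet_alphaFree (hεreg : 0 < θ₀.ν.εreg)
    (hε3 : (143 * (((((F.P K).d + 4 : ℕ) : ℝ)) ^ 2 / 4) ^ 2) * θ₀.ν.εreg ≤ 1 / 3)
    (hε2 : 2 * θ₀.ν.εreg ≤ 2 * deltaSU (Fin N) / ((((F.P K).d + 4) * (F.P K).L : ℕ) : ℝ) ^ 2) (hε29 : 0 < θ₀.ε₂₉)
    (hn1 : 1640 * (2 * (((((F.P K).d + 2) * (F.P K).L : ℕ) : ℝ) * θ₀.ε₂₉) +
        ((((F.P K).d + 2) * (F.P K).L : ℕ) : ℝ) ^ 2 / 4 * (2 * θ₀.ν.εreg / ((F.P K).L : ℝ) ^ 2)) * (((F.P K).L : ℝ) ^ ((F.P K).d - 1)) ^ 2 ≤ 1)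
    (hn2 : 13 * (2 * (((((F.P K).d + 2) * (F.P K).L : ℕ) : ℝ) * θ₀.ε₂₉) +
        ((((F.P K).d + 2) * (F.P K).L : ℕ) : ℝ) ^ 2 / 4 * (2 * θ₀.ν.εreg / ((F.P K).L : ℝ) ^ 2)) * ((F.P K).L : ℝ) ^ ((F.P K).d - 1) < deltaSU (Fin N))
    (h24 : ((((F.P K).d + 2) * (F.P K).L : ℕ) : ℝ) ^ 2 / 4 * θ₀.ν.ε₀ < 1 / 24)
    (h64 : 64 * (((((F.P K).d + 2) * (F.P K).L : ℕ) : ℝ) ^ 2 / 4 * θ₀.ν.ε₀) < deltaSU (Fin N))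
    (hL : 157 * (((((F.P K).d + 2) * (F.P K).L : ℕ) : ℝ) ^ 2 / 4 * θ₀.ν.ε₀) < ((((F.P K).L : ℝ)) ^ ((F.P K).d - 1))⁻¹)
    (hord : 2 * θ₀.ν.εreg / ((F.P K).L : ℝ) ^ 2 +
      4 * max θ₀.ε₂₉ (10 * (((((F.P K).d + 2) * (F.P K).L : ℕ) : ℝ) * θ₀.ε₂₉) * ((F.P K).L : ℝ) ^ ((F.P K).d - 1)) < θ₀.ν.ε₀)
    (hρm : ∀ j < K, Measurable (betaInputOfRecord F N (TcanOfRecord F N) (chiβOfRecord₁₃ F N θ₀) K g j))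
    (hint : ∀ j < K, Integrable (betaInputOfRecord F N (TcanOfRecord F N) (chiβOfRecord₁₃ F N θ₀) K g j) (fieldMeasure (F.P K) j (SU N)))
    (hsolν : ∀ j < K, ∀ W ∈ domAltOfRecord F N θ₀.ν K (j + 1), UkExists F N K (j + 1) θ₀.ν.εreg W)
    (hcrit : ∀ j < K, ContinuousOn (critCfgOfRecord F N θ₀.ν K j) (domAltOfRecord F N θ₀.ν K (j + 1)))
    (hGF : ∀ j < K, ContinuousOn (gfOfRecord F N K j) (domAltOfRecord F N θ₀.ν K j)) :
    ∀ j < K, domAltOfRecord F N θ₀.ν K (j + 1) ⊆ regSetOfRecord F N K j (betaInputOfRecord F N (TcanOfRecord F N) (chiβOfRecord₁₃ F N θ₀) K g j) ∧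
      ∀ V ∈ domAltOfRecord F N θ₀.ν K (j + 1), 0 < TcanOfRecord F N K j (betaInputOfRecord F N (TcanOfRecord F N) (chiβOfRecord₁₃ F N θ₀) K g j) V := by
  have hℓ := windowRadius_pos (F := F) K
  have hL0 : (0 : ℝ) < (F.P K).L := by exact_mod_cast (F.P K).L_pos
  have h2 : 0 < 2 * θ₀.ν.εreg / ((F.P K).L : ℝ) ^ 2 := div_pos (mul_pos two_pos hεreg) (pow_pos hL0 2)
  have hm : 0 ≤ 4 * max θ₀.ε₂₉ (10 * (((((F.P K).d + 2) * (F.P K).L : ℕ) : ℝ) * θ₀.ε₂₉) * ((F.P K).L : ℝ) ^ ((F.P K).d - 1)) :=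
    mul_nonneg (by norm_num) (le_max_of_le_left hε29.le)
  have hε₀ : 0 ≤ θ₀.ν.ε₀ := by linarith
  have hm0 : 0 ≤ ((((F.P K).d + 2) * (F.P K).L : ℕ) : ℝ) ^ 2 / 4 * θ₀.ν.ε₀ := mul_nonneg hℓ.le hε₀
  exact hreg_pos_all_of_localSupportSet θ₀ K g hεreg hε3 hε2 hε29 hn1 hn2 (α := ((((F.P K).d + 2) * (F.P K).L : ℕ) : ℝ) ^ 2 / 4 * θ₀.ν.ε₀)
    (mul_lt_mul_of_pos_left hord hℓ) h24.le (by linarith) hL hord hρm hint hsolν hcrit hGF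

end Tower

/-! ## §2 The door of p639613 in road A′'s currency, `huniq` discharged by dag-n09-w1 g7's `huniq_of_h11` -/

section Door

variable (θ : Stage13HParams F N) (h : θ.Provisos₁₃SepCoPH F N) {w : WorldP} (P : B12.RunParams)

/-- **The `huniq_of_h11` letter `2εbg ≤ ε₀·L²` is a theorem of the strict (hord) at `εreg = εbg`** (`0 < ε₂₉`). [cite: Balaban1985Averaging, Prop. 2 (53) p.26 (bookkeeping)] -/
theorem two_mul_εbg_le_of_hord (hε : 0 < θ.ε₂₉) (heq : θ.toStage13Params.ν.εreg = θ.εbg)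
    (hord' : 2 * θ.toStage13Params.ν.εreg / ((F.P P.K).L : ℝ) ^ 2 +
      4 * max θ.toStage13Params.ε₂₉ (10 * (((((F.P P.K).d + 2) * (F.P P.K).L : ℕ) : ℝ) * θ.toStage13Params.ε₂₉) * ((F.P P.K).L : ℝ) ^ ((F.P P.K).d - 1)) <
        θ.toStage13Params.ν.ε₀) :
    2 * θ.εbg ≤ θ.toStage13Params.ν.ε₀ * ((F.P P.K).L : ℝ) ^ 2 := by
  have hL0 : (0 : ℝ) < (F.P P.K).L := by exact_mod_cast (F.P P.K).L_pos
  have hm : 0 ≤ 4 * max θ.toStage13Params.ε₂₉ (10 * (((((F.P P.K).d + 2) * (F.P P.K).L : ℕ) : ℝ) * θ.toStage13Params.ε₂₉) * ((F.P P.K).L : ℝ) ^ ((F.P P.K).d - 1)) :=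
    mul_nonneg (by norm_num) (le_max_of_le_left hε.le)
  have h2 : 2 * θ.toStage13Params.ν.εreg / ((F.P P.K).L : ℝ) ^ 2 < θ.toStage13Params.ν.ε₀ := by linarith
  rw [← heq]
  exact ((div_lt_iff₀ (pow_pos hL0 2)).1 h2).le

/-- **★★★ N09's THEOREM-3 MEMBER AT THE STAGE-13 RECORD ON THE LOCAL ROUTE, α-FREE, `huniq`-FREE** (p639613's `thm3Member_stage13SepCoPH_atDomAlt_of_localRoute_of_numerics_of_εreg_eq` at
`α := (((d+2)L)²∕4)·ε₀` — `hαB` ⇐ strict (hord), `hα24`∕`hαδ`∕`hαL` ⇐ the three `ε₀`-lines — with the non-strict (hord) ⇐ the strict one and `huniq` ⇐ dag-n09-w1 g7's `huniq_of_h11` from the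
LEVEL-WISE `h11` + [B7] at `εbg = εreg` + `two_mul_εbg_le_of_hord`).  Displayed N09-side inputs: (181)ˢᵒˡ `hcov`, `hsolν`, `h11`, `hres` ([B11]), (I19) `hint`, (H-U) `hρm`, on-domain hcrit,
numerics in `(εreg, ε₂₉, ε₀; d, L, N)` only.  CONDITIONAL; nothing of Bałaban's asserted; N09 NOT discharged.
[cite: Balaban1987RG1, Thm 3 p.264, p.259, (0.11) p.253, (0.17)–(0.19) p.255, (2.9) p.266, (2.10) p.267; Balaban1985Variational, Thm 1 (8)–(10) p.279 and (181) p.307] -/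
theorem thm3Member_stage13SepCoPH_atDomAlt_of_localRoute_of_numerics_of_εreg_eq_alphaFree
    (hC : w.C = (datumOfRecord₁₃SepCoPH F N θ h).C) (hε : 0 < θ.ε₂₉) (heq : θ.toStage13Params.ν.εreg = θ.εbg)
    (hεreg : 0 < θ.toStage13Params.ν.εreg)
    (hε3 : (143 * (((((F.P P.K).d + 4 : ℕ) : ℝ)) ^ 2 / 4) ^ 2) * θ.toStage13Params.ν.εreg ≤ 1 / 3)
    (hε2 : 2 * θ.toStage13Params.ν.εreg ≤ 2 * deltaSU (Fin N) / ((((F.P P.K).d + 4) * (F.P P.K).L : ℕ) : ℝ) ^ 2)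
    (hn1 : 1640 * (2 * (((((F.P P.K).d + 2) * (F.P P.K).L : ℕ) : ℝ) * θ.toStage13Params.ε₂₉) +
        ((((F.P P.K).d + 2) * (F.P P.K).L : ℕ) : ℝ) ^ 2 / 4 * (2 * θ.toStage13Params.ν.εreg / ((F.P P.K).L : ℝ) ^ 2)) *
          (((F.P P.K).L : ℝ) ^ ((F.P P.K).d - 1)) ^ 2 ≤ 1)
    (hn2 : 13 * (2 * (((((F.P P.K).d + 2) * (F.P P.K).L : ℕ) : ℝ) * θ.toStage13Params.ε₂₉) +
        ((((F.P P.K).d + 2) * (F.P P.K).L : ℕ) : ℝ) ^ 2 / 4 * (2 * θ.toStage13Params.ν.εreg / ((F.P P.K).L : ℝ) ^ 2)) *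
          ((F.P P.K).L : ℝ) ^ ((F.P P.K).d - 1) < deltaSU (Fin N))
    (hcov : ∀ j < P.K, ∀ (v : GaugeTransf (F.P P.K) (j + 1) (SU N)) (W : GaugeField (F.P P.K) (j + 1) (SU N)),
      UkExists F N P.K (j + 1) θ.toStage13Params.ν.εreg W →
        critCfgOfRecord F N θ.toStage13Params.ν P.K j (gaugeAct v W) = gaugeAct (liftTransf v) (critCfgOfRecord F N θ.toStage13Params.ν P.K j W))
    (hsolν : ∀ j < P.K, ∀ W ∈ domAltOfRecord F N θ.ν P.K (j + 1), UkExists F N P.K (j + 1) θ.toStage13Params.ν.εreg W)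
    (hint : ∀ j < P.K, Integrable (betaInputOfRecord F N (TβOfRecord₁₃ F N) (chiβOfRecord₁₃ F N θ.toStage13Params) P.K (gOfRecord₁₃ F N θ.toStage13Params P) j)
      (fieldMeasure (F.P P.K) j (SU N)))
    (hρm : ∀ j < P.K, Measurable (betaInputOfRecord F N (TβOfRecord₁₃ F N) (chiβOfRecord₁₃ F N θ.toStage13Params) P.K (gOfRecord₁₃ F N θ.toStage13Params P) j))
    (hcrit : ∀ j < P.K, ContinuousOn (critCfgOfRecord F N θ.toStage13Params.ν P.K j) (domAltOfRecord F N θ.ν P.K (j + 1)))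
    -- road A′'s currency: the three `ε₀`-lines instead of `α`, `hαB hα24 hαδ hαL`
    (h24 : ((((F.P P.K).d + 2) * (F.P P.K).L : ℕ) : ℝ) ^ 2 / 4 * θ.toStage13Params.ν.ε₀ < 1 / 24)
    (h64 : 64 * (((((F.P P.K).d + 2) * (F.P P.K).L : ℕ) : ℝ) ^ 2 / 4 * θ.toStage13Params.ν.ε₀) < deltaSU (Fin N))
    (hL : 157 * (((((F.P P.K).d + 2) * (F.P P.K).L : ℕ) : ℝ) ^ 2 / 4 * θ.toStage13Params.ν.ε₀) < ((((F.P P.K).L : ℝ)) ^ ((F.P P.K).d - 1))⁻¹)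
    (hord' : 2 * θ.toStage13Params.ν.εreg / ((F.P P.K).L : ℝ) ^ 2 +
      4 * max θ.toStage13Params.ε₂₉ (10 * (((((F.P P.K).d + 2) * (F.P P.K).L : ℕ) : ℝ) * θ.toStage13Params.ε₂₉) * ((F.P P.K).L : ℝ) ^ ((F.P P.K).d - 1)) <
        θ.toStage13Params.ν.ε₀)
    (hε₀ : 0 ≤ θ.toStage13Params.ν.ε₀) (hfed : ((((F.P P.K).d * (F.P P.K).L : ℕ) : ℝ)) ^ 2 / 4 * θ.toStage13Params.ν.ε₀ < deltaFed (Fin N))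
    (h11 : ∀ k, k ≤ P.K → ∀ V ∈ domAltOfRecord F N θ.ν P.K k, UkExists F N P.K k θ.εbg V ∧ UniqueUkOrbit F N P.K k θ.εbg V)
    (hres : ∀ k, k ≤ P.K → HRestrict F N θ.εbg P.K k (domAltOfRecord F N θ.ν P.K k)) :
    (leavesP w P).smallCouplings → (leavesP w P).smallFieldInductive :=
  have hℓ := windowRadius_pos (F := F) P.K
  have hm0 : 0 ≤ ((((F.P P.K).d + 2) * (F.P P.K).L : ℕ) : ℝ) ^ 2 / 4 * θ.toStage13Params.ν.ε₀ := mul_nonneg hℓ.le hε₀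
  thm3Member_stage13SepCoPH_atDomAlt_of_localRoute_of_numerics_of_εreg_eq θ h P hC hε heq hεreg hε3 hε2 hord'.le hn1 hn2 hcov hsolν hint hρm hcrit
    (α := ((((F.P P.K).d + 2) * (F.P P.K).L : ℕ) : ℝ) ^ 2 / 4 * θ.toStage13Params.ν.ε₀) (mul_lt_mul_of_pos_left hord' hℓ) h24.le (by linarith) hL hord' hε₀ hfed
    h11 hres (huniq_of_h11 θ.ν (heq ▸ hεreg) (heq ▸ hε3) (heq ▸ hε2) (two_mul_εbg_le_of_hord θ P hε heq hord') h11)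

end Door

end Summit.QuantumFields.YangMills.BalabanUVNodes.N09RegularityTowerOfLocalRouteAlphaFree

end
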